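import Literature.NumberTheory.EllipticCurves.BurungaleSkinnerTianWan2024.CyclotomicPConverseRankFormProofs
import Literature.NumberTheory.EllipticCurves.BurungaleSkinnerTianWan2024.SignedMainStatementSemistableOPEN
import Literature.NumberTheory.EllipticCurves.BSDSelmerPConverse
import Literature.NumberTheory.EllipticCurves.BSDSelmerPConverseRankZeroOrdinaryProofs
import Literature.NumberTheory.EllipticCurves.AnalyticRankModularityProofs
import Literature.NumberTheory.EllipticCurves.PAdicBSDKatoFiniteProofs
import Literature.NumberTheory.EllipticCurves.AnticyclotomicPConverseLinks
import Literature.NumberTheory.EllipticCurves.CyclotomicIwasawaMainTheoremIrreducibleBaseChangeProofs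
import Literature.NumberTheory.EllipticCurves.Rank1Residual.GVParityTwistProofs
import Literature.NumberTheory.EllipticCurves.ModPIrreducibleCofinite
import Literature.NumberTheory.EllipticCurves.HeegnerPointReflectionProofs
import Literature.NumberTheory.EllipticCurves.LeadingTermProofs
import Literature.NumberTheory.QuadraticFields.FundamentalDiscriminant
import HarnessLib

/-!
# Burungale–Skinner–Tian–Wan Thm. 12.3 ("`p`-converse I") and Cor. 12.4 (`r = 1`) for an elliptic
# curve over `ℚ`: the printed proof REPLAYED IN THE KERNEL modulo the Prop. 12.1 OPEN binders and
# named print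

Paper of record: A. Burungale, C. Skinner, Y. Tian, X. Wan, *Zeta elements for elliptic curves and
applications*, arXiv:2409.01350v2 — an UNREFEREED PREPRINT. Typed ≠ proved ≠ endorsed. PROOFS ONLY:
this file introduces NO named fact and NO definition. It is the sequel of
`CyclotomicPConverseCriterionOPEN` (Prop. 12.1 as OPEN binders, gen 4) and
`CyclotomicPConverseRankFormProofs` (the binders in rank form, gen 4), written by the typer seat
`bsd-littype-01` (gen 5) of the cross-ladder literature-typing layer (D-0088(4)).

WHAT IS PROVED. Thm. 12.3 (p. 96, tex l.8146–8164) for `A_g = E` an elliptic curve (`F = ℚ`,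
`λ = p`): «`corank_{𝒪_λ} Sel_{λ^∞}(A_g) = 1`, `#Ш(A_g)[λ^∞] < ∞` ⟹ `ord_{s=1} L(s, A_g) = [F:ℚ]`»,
with the printed proof (p. 96, tex l.8165–8177) followed line by line:

1. «Since `corank Sel = 1`, note that `ε(A_g) = −1` by the proof of parity conjecture [N1]» — the
   tree's named fact `p_parity` (Dokchitser–Dokchitser / Nekovář), hypothesis `hpar`;
2. «Let `L` be an imaginary quadratic field satisfying (ord), (coprime) and (Heeg) so that
   `ord L(s, g/L) = ord L(s, g)`. The existence of `L` is a special case of the main result of [FH]»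
   — the tree's named fact `friedbergHoffstein_exists_heegnerField_split_twist_ne_zero`
   (`BSDSelmerPConverse`), hypothesis `hFH`; (coprime) is DERIVED from (Heeg)
   (`isCoprime_discr_of_satisfiesHeegnerHypothesis'`, Dedekind);
3. «As `L(1, g') ≠ 0`, the Selmer group `Sel(A_{g'})` is finite (cf. [K, Thm. 14.2])» — the tree's
   named fact `kato_finite_of_L_one_ne_zero`, hypothesis `hKato`;
4. «In view of the splitting `Sel(A_{g/L}) ≃ Sel(A_g) ⊕ Sel(A_{g'})` it follows that
   `corank Sel(A_{g/L}) = 1` and `Ш(A_{g/L})[λ^∞]` is finite. In particular, the hypothesis (inj)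
   holds» — TREE THEOREMS: `AcPConverseLinks.rank_corank_sha_baseChange_of_twist_L_one_ne_zero`
   (Silverman AEC Ex. 10.16, Greenberg's corank identity) and, for (inj), gen 4's
   `finite_strictSelmer_…_of_ncard_primesOver_eq_two` inside the rank-form corollaries;
5. «By Theorem 9.21 (c) and Theorem 10.1 Kato's main conjecture holds for `g` and the quadratic
   twist `g'` in `Λ ⊗ ℚ_p`» — ORDINARY branch: the REFEREED Burungale–Castella–Skinner 2025
   Thm. 1.1.2 (a) (tree fact `burungale_castella_skinner_charIdeal_eq_padicLFunction`, hypothesis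
   `hBCS`; `p ≥ 5`, (irr_ℚ)) through gen 4's `charIdealLePadicLFunctionRat_of_bcs`, applied to `E`
   AND to a globally minimal model of `E^{(d_L)}` — whose good ordinary reduction at `p` and
   irreducible `p`-torsion are PROVED here from those of `E` (`isOrdinaryAt_of_smul_eq_quadraticTwist`,
   `hasIrreducibleModPGaloisRep_of_smul_eq_quadraticTwist`; the squarefree kernel of `d_L` via
   `Quadratic.isFundamentalDiscriminant_discr`); SUPERSINGULAR branch (`a_p = 0`, `N` square-free):
   the paper's own Thm. 10.1, both clauses, as gen 3's OPEN binders
   `thm101_signedMainStatement_semistable_OPEN` / `thm101_twist_signedMainStatement_OPEN`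
   (hypotheses `h101`, `h101t`; the twist clause needs "discriminant coprime to `Np`", DERIVED here
   from (ord) + (Heeg));
6. «Hence, Proposition 12.1 concludes the proof» — gen 4's OPEN binders
   `prop121_pConverse_of_charIdealLe_ordinary_OPEN` / `…_signedCharIdealLe_supersingular_OPEN`
   (hypothesis `h121`) in rank form, and `ord L(E/L) = ord L(E) + ord L(E^{(d_L)}) = ord L(E) + 0`
   (`analyticRankEK_eq_add_of`, modularity `hasEntireLFunction_rat`, hypothesis `hE`;
   `analyticRank_eq_zero_of_entireLFunction_one_ne_zero`).

Then Cor. 12.4 (p. 96, label pcv-w) for `r = 1` and `A_g = E`: «`rank_ℤ E(ℚ) = 1`, `#Ш(E) < ∞` ⟹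
`ord_{s=1} L(s, E) = 1`», by the printed recipe «pick an ordinary prime `p ∤ 2N` so that `ρ`
satisfies (irr_ℚ)» — the tree theorem `exists_gt_mem_goodOrdinaryPrimes_hasIrreducibleModPGaloisRep`
(Serre 1981 §8 / AEC IX.6.3; no CM hypothesis is needed for the choice) — and Thm. 12.3.

And Cor. 12.4 for BOTH `r ∈ {0, 1}` (v2, §4): «the `r = 0` case from Theorem 9.21 (c)» is, in
the tree, already a theorem BELOW modularity and BCS25 1.1.2 (a) alone
(`analyticRank_eq_zero_of_selmerCorank_eq_zero_of_mazurMainConjecture`,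
`BSDSelmerPConverseRankZeroOrdinaryProofs`: Greenberg LNM 1716 Thm. 4.1 qualitative + interpolation),
so `rank_ℤ E(ℚ) ≤ 1 ∧ #Ш(E/ℚ) < ∞ ⟹ ord_{s=1} L(E, s) = rank_ℤ E(ℚ)` holds modulo the ordinary
Prop. 12.1 binder + REFEREED print (`analyticRank_eq_mordellWeilRank_of_prop121_ordinary_OPEN_of_le_one`).

And (v3, §5) the tree's REFEREED interim statement bsd.S25 = Kim 2022 Cor. 1.4
(`kim_analyticRank_eq_one_of_mordellWeilRank_eq_one`: non-CM `E/ℚ`, `p > 3` good ordinary, `E[p]`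
irreducible, `rank = 1 ∧ #Ш[p^∞] < ∞ ⟹ ord = 1 ∧ #Ш < ∞`) is REACHED A SECOND WAY — from the ordinary
Prop. 12.1 binder + BCS25 1.1.2 (a) + parity + Friedberg–Hoffstein + Gross–Zagier–Kolyvagin (bsd.S17,
which also supplies Kato's finiteness, `kato_finite_of_L_one_ne_zero_of_rank_eq_analyticRank`) +
modularity, the non-CM hypothesis UNUSED (`kim_analyticRank_eq_one_of_mordellWeilRank_eq_one_of_prop121_ordinary_OPEN`).

And (v4, §6) the MODEL-FREE forms (any Weierstrass model of `E/ℚ`, via a global minimal model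
`C • W` and the isomorphism invariance of `rank`, `Ш`, `ord`: `hasGlobalMinimalModel_rat_holds`,
`mordellWeilRank_variableChange_holds`, `shaEquiv`, `analyticRank_smul`): Cor. 12.4 `r ∈ {0,1}` and, with
Gross–Zagier–Kolyvagin (bsd.S17), the equivalence `rank_ℤ E(ℚ) = 1 ∧ #Ш < ∞ ⟺ ord_{s=1} L(E,s) = 1`
for EVERY `E/ℚ` modulo the ordinary Prop. 12.1 binder + REFEREED print — the tree's
`mordellWeilRank_eq_one_and_finite_sha_iff_analyticRank_eq_one` (Kim Cor. 1.4 + Burungale–Tian + GZK)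
reached without the CM case split.

TRUST BASE of the ordinary statements: ONE preprint binder (Prop. 12.1, ordinary branch) + the
REFEREED named facts BCS25 1.1.2 (a), Dokchitser–Dokchitser (parity), Friedberg–Hoffstein, Kato 14.2,
modularity. Of the supersingular statements: THREE preprint binders (Prop. 12.1 ss branch, Thm. 10.1
both clauses) + parity, FH, Kato, modularity. Nothing is asserted about any binder.

FAITHFULNESS. Hypotheses of the ordinary theorem = print's for `A_g = E` at `p ≥ 5` (print: `p ∤ 2N`,
`λ ∤ a_p`, (irr_ℚ) in the non-CM case, (ram) if `p = 3`): WEAKER at `p = 3` (not covered: BCS25 needs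
`p ≥ 5`) and for CM curves at `p ≥ 5` we ask (irr_ℚ) too (print cites [Ru1] there) — never stronger.
Supersingular theorem: print's «`a_p = 0` and `N` square-free»; no (irr)/(ram) asked (none is asked by
the Thm. 10.1 binders). Cor. 12.4 (`r = 1`): print's hypotheses verbatim for `A_g = E` (CM or not).

## References
* [BurungaleSkinnerTianWan2024] arXiv:2409.01350v2: Prop. 12.1 (p. 95; tex l.8089–8110), Thm. 12.3
  (p. 96; label p-converse, l.8146–8164) and its proof (l.8165–8177), Cor. 12.4 (p. 96; label pcv-w,
  l.8189–8196) and its proof (l.8197–8206).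
* [BurungaleCastellaSkinner2025] IMRN 2025 = arXiv:2405.00270v2, Thm. 1.1.2 (a).
* [DokchitserDokchitserAnnals2010] Ann. of Math. 172, Thm. 1.4 (`p_parity`).
* [FriedbergHoffstein1995] Ann. of Math. 142, main theorem (special case, `BSDSelmerPConverse`).
* [Kato2004Asterisque] Astérisque 295, Thm. 14.2 / Cor. 14.3.
* [SilvermanAEC2009] Exercise 10.16 (rank over a quadratic field), X.5 Cor. 5.4 (twists).
* [Marcus2018] Number Fields, Ch. 2 Thm. 1 (fundamental discriminants).
-/

noncomputable section

open scoped Classical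

open WeierstrassCurve NumberField IsDedekindDomain Literature.NumberTheory.EllipticCurves
  Literature.NumberTheory.EllipticCurves.Rank1Residual

namespace Literature.NumberTheory.EllipticCurves.BurungaleSkinnerTianWan2024

/-! ### §0. Bookkeeping the printed proof leaves implicit (all PROVED, no facts) -/

/-- **(Heeg) ⟹ (coprime).** For an imaginary quadratic `K` in which every prime factor of `N` splits,
`(d_K, N) = 1`: a split prime is unramified, hence does not divide `d_K` (Dedekind; tree theorem
`not_dvd_discr_of_satisfiesHeegnerHypothesis`). BSTW (9.9) "(D_L, N) = 1" from (Heeg). Private twin of the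
Summits-side `KolyvaginAssembly.isCoprime_discr_of_satisfiesHeegnerHypothesis`. [folklore] -/
private theorem isCoprime_discr_of_satisfiesHeegnerHypothesis' {K : Type*} [Field K] [NumberField K]
    (hK : IsImaginaryQuadratic K) {N : ℕ} (hH : SatisfiesHeegnerHypothesis N K) :
    IsCoprime (NumberField.discr K) (N : ℤ) := by
  refine IsCoprime.symm ?_
  rw [Int.isCoprime_iff_gcd_eq_one, Int.gcd_eq_natAbs, Int.natAbs_natCast]
  refine Nat.Coprime.gcd_eq_one (Nat.coprime_of_dvd fun k hk hkN hkd ↦ ?_)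
  exact not_dvd_discr_of_satisfiesHeegnerHypothesis hK hH hk hkN (Int.ofNat_dvd_left.mpr hkd)

/-- **`corank_{ℤ_p} Sel_{p^∞}(E/K) = 1` and `#Ш(E/K)[p^∞] < ∞` give `rank_ℤ E(K) = 1`** (Greenberg's
corank identity `corank Sel = rank + corank Ш[p^∞]`, tree theorem
`selmerCorank_eq_mordellWeilRank_add_holds`, with `corank Ш[p^∞] = 0` for finite `Ш[p^∞]`).
[cite: Greenberg1999LNM, §1 pp. 54–57] -/
theorem mordellWeilRank_eq_one_of_selmerCorank_eq_one {K : Type*} [Field K] [NumberField K]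
    (W : WeierstrassCurve K) [W.IsElliptic] (p : ℕ) [Fact p.Prime] (h : W.selmerCorank p = 1)
    [Finite (AddCommGroup.primaryComponent W.sha p)] : W.mordellWeilRank = 1 := by
  have h0 : W.shaCorank p = 0 := zpCorank_eq_zero_of_finite _ p
  have h1 := W.selmerCorank_eq_mordellWeilRank_add_holds p
  omega

/-- **The squarefree kernel of a quadratic field discriminant, with its ramification dictionary.**
For a quadratic field `K`, `d_K = m · f²` with `m` squarefree, `m ≠ 1`, `f ∈ {1, 2}`, and every prime
`q` ramified in `ℚ(√m)` in the elementary spelling `RamifiedInQuadratic m q` (`q ∣ m`, or `q = 2` and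
`m ≢ 1 (mod 4)`) divides `d_K`. From the tree theorem `Quadratic.isFundamentalDiscriminant_discr`
(`d_K ≡ 1 (mod 4)` squarefree, or `d_K = 4m'` with `m' ≡ 2, 3 (mod 4)` squarefree; Marcus, Number
Fields, Ch. 2 Thm. 1). [cite: Marcus2018, Ch. 2 Thm. 1] -/
theorem exists_squarefree_discr_eq_mul_sq {K : Type*} [Field K] [NumberField K]
    (h2 : Module.finrank ℚ K = 2) :
    ∃ (m f : ℤ), Squarefree m ∧ m ≠ 1 ∧ f ≠ 0 ∧ NumberField.discr K = m * f ^ 2 ∧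
      ∀ q : ℕ, q.Prime → RamifiedInQuadratic m q → (q : ℤ) ∣ NumberField.discr K := by
  rcases Literature.NumberTheory.QuadraticFields.Quadratic.isFundamentalDiscriminant_discr h2 with
    ⟨h1, hsq, hne⟩ | ⟨h4, hm4, hsq⟩
  · refine ⟨NumberField.discr K, 1, hsq, hne, one_ne_zero, by ring, fun q _ hram ↦ ?_⟩
    rcases hram with h | ⟨-, h⟩
    · exact h
    · exact absurd h1 h
  · refine ⟨NumberField.discr K / 4, 2, hsq, by omega, two_ne_zero, ?_, fun q _ hram ↦ ?_⟩
    · rw [show (2 : ℤ) ^ 2 = 4 by norm_num, Int.ediv_mul_cancel h4]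
    · rcases hram with h | ⟨rfl, -⟩
      · exact h.trans (Int.ediv_dvd_of_dvd h4)
      · exact (show ((2 : ℕ) : ℤ) ∣ 4 by norm_num).trans h4

/-- **Irreducibility of `E[p]` passes to quadratic twists.** If `C • W' = W^{(d)}` (`d ≠ 0`) and `E[p]`
is an irreducible `Γ_ℚ`-module, so is `E^{(d)}[p]`: `W` is in turn a model of the twist of `W'` by `d`
(`(W^{(d)})^{(d)} = W^{(d²)} ≅ W`), and a rational line of `E'[p]` would transport to one of `E[p]`
along the twist isomorphism (tree theorem `Rank1Residual.not_hasIrreducibleModPGaloisRep_twist`,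
Silverman AEC X.5 Cor. 5.4). [cite: SilvermanAEC2009, X.5 Cor. 5.4] -/
theorem hasIrreducibleModPGaloisRep_of_smul_eq_quadraticTwist (W W' : WeierstrassCurve ℚ)
    [W.IsElliptic] [W'.IsElliptic] (p : ℕ) [Fact p.Prime] {d : ℚ} (hd : d ≠ 0)
    {C : VariableChange ℚ} (hC : C • W' = W.quadraticTwist d)
    (hirr : W.HasIrreducibleModPGaloisRep p) : W'.HasIrreducibleModPGaloisRep p := by
  by_contra hred
  obtain ⟨D, hD⟩ := exists_quadraticTwist_quadraticTwist_eq_smul W hd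
  have hW' : W' = C⁻¹ • W.quadraticTwist d := by rw [← hC, inv_smul_smul]
  have key : ((⟨C⁻¹.u, d * C⁻¹.r, 0, 0⟩ : VariableChange ℚ) * D) • W = W'.quadraticTwist d := by
    rw [mul_smul, ← hD, hW', quadraticTwist_smul]
  exact not_hasIrreducibleModPGaloisRep_twist hred hd W _ key hirr

/-- **Globally minimal models of `E^{(d_K)}` for a quadratic field `K`.** There are a globally minimal
`W'/ℚ` with `C • W' = W^{(d_K)}` (Néron; tree `exists_isGloballyMinimal_smul_eq_quadraticTwist`) and,
for the squarefree kernel `m` of `d_K = m f²` (`exists_squarefree_discr_eq_mul_sq`), a second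
isomorphism `C' • W' = W^{(m)}` (`W^{(m f²)} ≅ W^{(m)}`, tree
`exists_variableChange_quadraticTwist_mul_sq`); `m` is squarefree, `≠ 1`, divides `d_K`, and its
ramified primes divide `d_K`. [cite: SilvermanAEC2009, VIII.8 Cor. 8.3 and X.5 Cor. 5.4] -/
theorem exists_isGloballyMinimal_twist_models (W : WeierstrassCurve ℚ) [W.IsElliptic]
    {K : Type*} [Field K] [NumberField K] (h2 : Module.finrank ℚ K = 2) :
    ∃ (W' : WeierstrassCurve ℚ) (_ : W'.IsElliptic) (_ : W'.IsGloballyMinimal)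
      (C C' : VariableChange ℚ) (m : ℤ),
      C • W' = W.quadraticTwist (NumberField.discr K : ℚ) ∧ C' • W' = W.quadraticTwist (m : ℚ) ∧
        Squarefree m ∧ m ≠ 1 ∧ m ∣ NumberField.discr K ∧
          ∀ q : ℕ, q.Prime → RamifiedInQuadratic m q → (q : ℤ) ∣ NumberField.discr K := by
  obtain ⟨m, f, hsq, hm1, hf, hdK, hram⟩ := exists_squarefree_discr_eq_mul_sq h2
  have hd : (NumberField.discr K : ℚ) ≠ 0 := by exact_mod_cast NumberField.discr_ne_zero K
  obtain ⟨W', _, _, C, hC⟩ := exists_isGloballyMinimal_smul_eq_quadraticTwist W hd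
  have hfQ : (f : ℚ) ≠ 0 := by exact_mod_cast hf
  obtain ⟨C₀, hC₀⟩ := W.exists_variableChange_quadraticTwist_mul_sq (m : ℚ) (f : ℚ) hfQ
  have hcast : (NumberField.discr K : ℚ) = (m : ℚ) * (f : ℚ) ^ 2 := by
    rw [hdK]; push_cast; ring
  refine ⟨W', ‹_›, ‹_›, C, C₀⁻¹ * C, m, hC, ?_, hsq, hm1, ⟨f ^ 2, by rw [hdK]⟩, hram⟩
  rw [mul_smul, hC, hcast, ← hC₀, inv_smul_smul]

/-! ### §1. Thm. 12.3, ORDINARY branch (`p ≥ 5`), modulo the Prop. 12.1 binder + REFEREED print -/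

/-- **Burungale–Skinner–Tian–Wan Thm. 12.3 ("`p`-converse I"), ordinary branch, for an elliptic curve —
REPLAYED from the printed proof (p. 96) modulo the Prop. 12.1 OPEN binder and named REFEREED print.**
Granted: `h121` the ordinary Prop. 12.1 binder (PREPRINT, OPEN — NEVER a theorem), `hBCS` the REFEREED
Burungale–Castella–Skinner 2025 Thm. 1.1.2 (a), `hpar` the `p`-parity theorem, `hFH` the
Friedberg–Hoffstein field, `hKato` Kato's Thm. 14.2 and `hE` modularity (entire continuation). Then
for `W/ℚ` globally minimal, `p ≥ 5` a prime of good ordinary reduction with `E[p]` irreducible: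
`corank_{ℤ_p} Sel_{p^∞}(E/ℚ) = 1 ∧ #Ш(E/ℚ)[p^∞] < ∞ ⟹ ord_{s=1} L(E, s) = 1`.
Proof = the printed one (module docstring, steps 1–6): parity ⇒ `w(E) = −1`; FH field `K` with (Heeg),
(ord) and `L(E^{(d_K)}, 1) ≠ 0`; Kato ⇒ `E^{(d_K)}(ℚ)` and `Sel_{p^∞}(E^{(d_K)})` finite; base change
⇒ `rank E(K) = 1`, `Ш(E/K)[p^∞]` finite; BCS 1.1.2 (a) for `E` and for a globally minimal model of
`E^{(d_K)}` (good ordinary at `p ∤ 2 d_K` with irreducible `p`-torsion — proved); Prop. 12.1 (rank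
form) ⇒ `ord L(E/K) = 1 = ord L(E) + ord L(E^{(d_K)}) = ord L(E) + 0`. WEAKER than print at `p = 3`
and for CM curves (both outside). [claim: BurungaleSkinnerTianWan2024, status: under-review]
[cite: BurungaleSkinnerTianWan2024, Thm. 12.3 and its proof (p. 96; tex l.8146–8177), Prop. 12.1 (p. 95; OPEN binder)]
[cite: BurungaleCastellaSkinner2025, Thm. 1.1.2 (a) (p. 2 of arXiv:2405.00270v2)] -/
theorem analyticRank_eq_one_of_prop121_ordinary_OPEN_of_selmerCorank_eq_one
    (h121 : prop121_pConverse_of_charIdealLe_ordinary_OPEN.{0})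
    (hBCS : burungale_castella_skinner_charIdeal_eq_padicLFunction)
    (hpar : ∀ (W : WeierstrassCurve ℚ) [W.IsElliptic] (p : ℕ) [Fact p.Prime], p_parity W p)
    (hFH : friedbergHoffstein_exists_heegnerField_split_twist_ne_zero)
    (hKato : ∀ (W : WeierstrassCurve ℚ) [W.IsElliptic] (p : ℕ) [Fact p.Prime],
      kato_finite_of_L_one_ne_zero W p)
    (hE : hasEntireLFunction_rat)
    (W : WeierstrassCurve ℚ) [W.IsElliptic] [W.IsGloballyMinimal] (p : ℕ) [Fact p.Prime]
    (hp : 5 ≤ p) (hgood : W.HasGoodReductionAtPrime p) (hord : ¬ (p : ℤ) ∣ W.frobeniusTrace p)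
    (hirr : W.HasIrreducibleModPGaloisRep p) (hcorank : W.selmerCorank p = 1)
    (hsha : Finite (AddCommGroup.primaryComponent W.sha p)) : W.analyticRank = 1 := by
  have hpP : p.Prime := Fact.out
  have hp2 : p ≠ 2 := by omega
  -- step 1: parity, `w(E) = -1`
  have hw : W.rootNumber = -1 := by
    have h := hpar W p
    unfold p_parity at h
    rw [hcorank, pow_one] at h
    exact h.symm
  -- rank `1` over `ℚ`
  haveI := hsha
  have hrank : W.mordellWeilRank = 1 := mordellWeilRank_eq_one_of_selmerCorank_eq_one W p hcorank
  -- step 2: the Friedberg–Hoffstein field `K` with (Heeg), (ord) and `L(E^{(d_K)}, 1) ≠ 0`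
  obtain ⟨K, _, _, hK, -, hHN, hHp, hL1⟩ := hFH W hw p hpP 0
  have hsplit : ((Ideal.span {(p : ℤ)}).primesOver (𝓞 K)).ncard = 2 := hHp p hpP dvd_rfl
  have hcop : IsCoprime (NumberField.discr K) (W.conductorNorm ℤ) :=
    isCoprime_discr_of_satisfiesHeegnerHypothesis' hK hHN
  have hpd : ¬ (p : ℤ) ∣ NumberField.discr K :=
    not_dvd_discr_of_satisfiesHeegnerHypothesis hK hHp hpP dvd_rfl
  -- steps 3–4: Kato for the twist and base change: `rank E(K) = 1`, `Ш(E/K)[p^∞]` finite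
  obtain ⟨hrankK, -, hshaK⟩ :=
    AcPConverseLinks.rank_corank_sha_baseChange_of_twist_L_one_ne_zero hKato W p hK hL1 hrank hsha
  -- a globally minimal model `W'` of `E^{(d_K)}`, good ordinary at `p` with irreducible `p`-torsion
  obtain ⟨W', _, _, C, C', m, hC, hC', hsq, -, hmd, -⟩ := exists_isGloballyMinimal_twist_models W hK.1
  have hpm : ¬ (p : ℤ) ∣ m := fun h ↦ hpd (h.trans hmd)
  have hord' : IsOrdinaryAt W' p :=
    isOrdinaryAt_of_smul_eq_quadraticTwist W W' hsq hC' p hp2 hpm ⟨hgood, hord⟩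
  have hm0 : (m : ℚ) ≠ 0 := by
    have : m ≠ 0 := fun h ↦ by
      rw [h, zero_dvd_iff] at hmd
      exact NumberField.discr_ne_zero K hmd
    exact_mod_cast this
  have hirr' : W'.HasIrreducibleModPGaloisRep p :=
    hasIrreducibleModPGaloisRep_of_smul_eq_quadraticTwist W W' p hm0 hC' hirr
  -- steps 5–6: BCS 1.1.2 (a) twice + Prop. 12.1 (rank form): `ord_{s=1} L(E/K, s) = 1`
  have hEK : analyticRankEK W K = 1 :=
    analyticRankEK_eq_one_of_prop121_ordinary_OPEN_of_bcs_of_mordellWeilRank_eq_one h121 hBCS W W'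
      K p hp hgood hord hirr hord'.1 hord'.2 hirr' hK hsplit hcop hHN hC hrankK hshaK
  -- `ord L(E/K) = ord L(E) + ord L(E^{(d_K)}) = ord L(E) + 0`
  rw [analyticRankEK_eq_add_of hE W K, analyticRank_eq_zero_of_entireLFunction_one_ne_zero _ hL1,
    add_zero] at hEK
  exact hEK

/-- **Thm. 12.3, ordinary branch, RANK form** (the hypothesis as print states it for `A_g = E`:
«`corank Sel_{λ^∞}(A_g) = 1, #Ш(A_g)[λ^∞] < ∞`» ⟺ `rank_ℤ E(ℚ) = 1 ∧ #Ш(E/ℚ)[p^∞] < ∞` by the corank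
identity): granted the same binder and named print, for `W/ℚ` globally minimal and `p ≥ 5` good
ordinary with `E[p]` irreducible, `rank_ℤ E(ℚ) = 1 ∧ #Ш(E/ℚ)[p^∞] < ∞ ⟹ ord_{s=1} L(E, s) = 1`.
[claim: BurungaleSkinnerTianWan2024, status: under-review]
[cite: BurungaleSkinnerTianWan2024, Thm. 12.3 and its proof (p. 96), Prop. 12.1 (p. 95; OPEN binder)]
[cite: BurungaleCastellaSkinner2025, Thm. 1.1.2 (a) (p. 2 of arXiv:2405.00270v2)] -/
theorem analyticRank_eq_one_of_prop121_ordinary_OPEN_of_mordellWeilRank_eq_one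
    (h121 : prop121_pConverse_of_charIdealLe_ordinary_OPEN.{0})
    (hBCS : burungale_castella_skinner_charIdeal_eq_padicLFunction)
    (hpar : ∀ (W : WeierstrassCurve ℚ) [W.IsElliptic] (p : ℕ) [Fact p.Prime], p_parity W p)
    (hFH : friedbergHoffstein_exists_heegnerField_split_twist_ne_zero)
    (hKato : ∀ (W : WeierstrassCurve ℚ) [W.IsElliptic] (p : ℕ) [Fact p.Prime],
      kato_finite_of_L_one_ne_zero W p)
    (hE : hasEntireLFunction_rat)
    (W : WeierstrassCurve ℚ) [W.IsElliptic] [W.IsGloballyMinimal] (p : ℕ) [Fact p.Prime]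
    (hp : 5 ≤ p) (hgood : W.HasGoodReductionAtPrime p) (hord : ¬ (p : ℤ) ∣ W.frobeniusTrace p)
    (hirr : W.HasIrreducibleModPGaloisRep p) (hrank : W.mordellWeilRank = 1)
    (hsha : Finite (AddCommGroup.primaryComponent W.sha p)) : W.analyticRank = 1 := by
  haveI := hsha
  exact analyticRank_eq_one_of_prop121_ordinary_OPEN_of_selmerCorank_eq_one h121 hBCS hpar hFH hKato
    hE W p hp hgood hord hirr (selmerCorank_eq_one_of_mordellWeilRank_eq_one_of_finite W p hrank hsha)
    hsha

/-! ### §2. Cor. 12.4 (`r = 1`) for an elliptic curve, modulo the ordinary Prop. 12.1 binder +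
REFEREED print -/

/-- **Burungale–Skinner–Tian–Wan Cor. 12.4 (label pcv-w), case `r = 1`, for an elliptic curve — REPLAYED
from the printed proof (p. 96) modulo the ordinary Prop. 12.1 OPEN binder and named REFEREED print.**
«`rank_ℤ A_g(ℚ) = r [F:ℚ]`, `#Ш(A_g) < ∞` ⟹ `ord_{s=1} L(s, A_g) = r [F:ℚ]`» for `A_g = E`, `r = 1`:
for EVERY elliptic curve `E/ℚ` (globally minimal model `W`), `rank_ℤ E(ℚ) = 1 ∧ #Ш(E/ℚ) < ∞ ⟹
ord_{s=1} L(E, s) = 1`. Proof as printed: «pick an ordinary prime `p ∤ 2N` so that `ρ` satisfies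
(irr_ℚ)» — the tree THEOREM `exists_gt_mem_goodOrdinaryPrimes_hasIrreducibleModPGaloisRep` gives a
good ordinary `p > 4` with `E[p]` irreducible (for every `E/ℚ`; print treats CM curves by [Ru1, BuTi]
instead) — then Thm. 12.3 (`analyticRank_eq_one_of_prop121_ordinary_OPEN_of_mordellWeilRank_eq_one`).
Trust base: ONE preprint binder + BCS25 1.1.2 (a), parity, Friedberg–Hoffstein, Kato 14.2, modularity.
[claim: BurungaleSkinnerTianWan2024, status: under-review]
[cite: BurungaleSkinnerTianWan2024, Cor. 12.4 and its proof (p. 96; label pcv-w, tex l.8189–8206), Thm. 12.3 (p. 96), Prop. 12.1 (p. 95; OPEN binder)]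
[cite: BurungaleCastellaSkinner2025, Thm. 1.1.2 (a) (p. 2 of arXiv:2405.00270v2)] -/
theorem analyticRank_eq_one_of_prop121_ordinary_OPEN_of_mordellWeilRank_eq_one_of_finite_sha
    (h121 : prop121_pConverse_of_charIdealLe_ordinary_OPEN.{0})
    (hBCS : burungale_castella_skinner_charIdeal_eq_padicLFunction)
    (hpar : ∀ (W : WeierstrassCurve ℚ) [W.IsElliptic] (p : ℕ) [Fact p.Prime], p_parity W p)
    (hFH : friedbergHoffstein_exists_heegnerField_split_twist_ne_zero)
    (hKato : ∀ (W : WeierstrassCurve ℚ) [W.IsElliptic] (p : ℕ) [Fact p.Prime],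
      kato_finite_of_L_one_ne_zero W p)
    (hE : hasEntireLFunction_rat)
    (W : WeierstrassCurve ℚ) [W.IsElliptic] [W.IsGloballyMinimal] (hrank : W.mordellWeilRank = 1)
    [Finite W.sha] : W.analyticRank = 1 := by
  obtain ⟨p, h4p, ⟨hpF, hgood, hord⟩, hirr⟩ :=
    exists_gt_mem_goodOrdinaryPrimes_hasIrreducibleModPGaloisRep W 4
  haveI := hpF
  exact analyticRank_eq_one_of_prop121_ordinary_OPEN_of_mordellWeilRank_eq_one h121 hBCS hpar hFH
    hKato hE W p (by omega) hgood hord hirr hrank inferInstance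

/-! ### §3. Thm. 12.3, SUPERSINGULAR branch (`a_p = 0`, `N` square-free), modulo the Prop. 12.1 binder
and the Thm. 10.1 binders (all PREPRINT) -/

/-- **Burungale–Skinner–Tian–Wan Thm. 12.3 ("`p`-converse I"), supersingular branch `a_p = 0` with `N`
square-free, for an elliptic curve — REPLAYED from the printed proof (p. 96) modulo the paper's OWN OPEN
binders (Prop. 12.1 supersingular branch; Thm. 10.1 = Kobayashi's main conj. for `g` AND for the
prime-to-`Np` quadratic twist `g ⊗ χ_L` — all PREPRINT, NEVER theorems) and named print (parity,
Friedberg–Hoffstein, Kato 14.2, modularity).** For `W/ℚ` globally minimal and semistable, `p ≠ 2` a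
prime of good reduction with `a_p = 0`: `corank_{ℤ_p} Sel_{p^∞}(E/ℚ) = 1 ∧ #Ш(E/ℚ)[p^∞] < ∞ ⟹
ord_{s=1} L(E, s) = 1`. The twist clause's hypothesis «discriminant coprime to `Np`» is DERIVED for
the Friedberg–Hoffstein field from (ord) and (Heeg) (its squarefree kernel `m` of `d_L`: every prime
ramified in `ℚ(√m)` divides `d_L`, `exists_isGloballyMinimal_twist_models`), and the signed one-sided
halves for `E`, `E^{(d_L)}` from the binders via `signedCharIdealLePadicLFunctionRat_of_signedCharIdealEq`.
[claim: BurungaleSkinnerTianWan2024, status: under-review]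
[cite: BurungaleSkinnerTianWan2024, Thm. 12.3 and its proof (p. 96; tex l.8146–8177), Prop. 12.1 with Remark 12.2 (pp. 95–96; OPEN binder), Thm. 10.1 both clauses (p. 86; OPEN binders)] -/
theorem analyticRank_eq_one_of_prop121_supersingular_OPEN_of_thm101_OPEN_of_selmerCorank_eq_one
    (h121 : prop121_pConverse_of_signedCharIdealLe_supersingular_OPEN.{0})
    (h101 : thm101_signedMainStatement_semistable_OPEN)
    (h101t : thm101_twist_signedMainStatement_OPEN)
    (hpar : ∀ (W : WeierstrassCurve ℚ) [W.IsElliptic] (p : ℕ) [Fact p.Prime], p_parity W p)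
    (hFH : friedbergHoffstein_exists_heegnerField_split_twist_ne_zero)
    (hKato : ∀ (W : WeierstrassCurve ℚ) [W.IsElliptic] (p : ℕ) [Fact p.Prime],
      kato_finite_of_L_one_ne_zero W p)
    (hE : hasEntireLFunction_rat)
    (W : WeierstrassCurve ℚ) [W.IsElliptic] [W.IsGloballyMinimal] (p : ℕ) [Fact p.Prime]
    (hp2 : p ≠ 2) (hsst : Semistable W) (hgood : W.HasGoodReductionAtPrime p)
    (hap : W.frobeniusTrace p = 0) (hcorank : W.selmerCorank p = 1)
    (hsha : Finite (AddCommGroup.primaryComponent W.sha p)) : W.analyticRank = 1 := by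
  have hpP : p.Prime := Fact.out
  -- step 1: parity, `w(E) = -1`
  have hw : W.rootNumber = -1 := by
    have h := hpar W p
    unfold p_parity at h
    rw [hcorank, pow_one] at h
    exact h.symm
  haveI := hsha
  have hrank : W.mordellWeilRank = 1 := mordellWeilRank_eq_one_of_selmerCorank_eq_one W p hcorank
  -- step 2: the Friedberg–Hoffstein field
  obtain ⟨K, _, _, hK, -, hHN, hHp, hL1⟩ := hFH W hw p hpP 0
  have hsplit : ((Ideal.span {(p : ℤ)}).primesOver (𝓞 K)).ncard = 2 := hHp p hpP dvd_rfl
  have hcop : IsCoprime (NumberField.discr K) (W.conductorNorm ℤ) :=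
    isCoprime_discr_of_satisfiesHeegnerHypothesis' hK hHN
  have hpd : ¬ (p : ℤ) ∣ NumberField.discr K :=
    not_dvd_discr_of_satisfiesHeegnerHypothesis hK hHp hpP dvd_rfl
  -- steps 3–4: Kato for the twist and base change
  obtain ⟨hrankK, -, hshaK⟩ :=
    AcPConverseLinks.rank_corank_sha_baseChange_of_twist_L_one_ne_zero hKato W p hK hL1 hrank hsha
  -- a globally minimal model `W'` of `E^{(d_K)}` = the twist by the squarefree kernel `m` of `d_K`
  obtain ⟨W', _, _, C, C', m, hC, hC', hsq, hm1, -, hram⟩ :=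
    exists_isGloballyMinimal_twist_models W hK.1
  -- «discriminant coprime to `Np`»: the primes ramified in `ℚ(√m) = K` divide `d_K`
  have hram' : ∀ (q : ℕ) [Fact q.Prime], RamifiedInQuadratic m q →
      q ≠ p ∧ ¬ q ∣ W.conductorNorm ℤ := by
    intro q hq hq'
    have hqd : (q : ℤ) ∣ NumberField.discr K := hram q hq.out hq'
    refine ⟨?_, fun hqN ↦ not_dvd_discr_of_satisfiesHeegnerHypothesis hK hHN hq.out hqN hqd⟩
    rintro rfl
    exact hpd hqd
  -- step 5: Thm. 10.1 for `E` and its twist clause for `E^{(d_K)}`, then the one-sided halves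
  have hle : ∀ ε : ℤˣ, SignedCharIdealLePadicLFunctionRat W p ε := fun ε ↦
    signedCharIdealLePadicLFunctionRat_of_signedCharIdealEq (h101 W p hp2 hsst hgood hap ε)
  have hle' : ∀ ε : ℤˣ, SignedCharIdealLePadicLFunctionRat W' p ε := fun ε ↦
    signedCharIdealLePadicLFunctionRat_of_signedCharIdealEq
      (h101t W W' p m C' hp2 hsst hgood hap hsq hm1 hram' hC' ε)
  -- step 6: Prop. 12.1 (rank form) and the factorisation of `ord L(E/K)`
  have hEK : analyticRankEK W K = 1 :=
    analyticRankEK_eq_one_of_prop121_supersingular_OPEN_of_mordellWeilRank_eq_one h121 W W' K p hp2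
      hgood hap hK hsplit hcop hHN hC hle hle' hrankK hshaK
  rw [analyticRankEK_eq_add_of hE W K, analyticRank_eq_zero_of_entireLFunction_one_ne_zero _ hL1,
    add_zero] at hEK
  exact hEK

/-- **Thm. 12.3, supersingular branch, RANK form**: granted the same three preprint binders and named
print, for `W/ℚ` globally minimal and semistable and `p ≠ 2` good with `a_p = 0`,
`rank_ℤ E(ℚ) = 1 ∧ #Ш(E/ℚ)[p^∞] < ∞ ⟹ ord_{s=1} L(E, s) = 1`.
[claim: BurungaleSkinnerTianWan2024, status: under-review]
[cite: BurungaleSkinnerTianWan2024, Thm. 12.3 and its proof (p. 96), Prop. 12.1 (p. 95; OPEN binder), Thm. 10.1 (p. 86; OPEN binders)] -/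
theorem analyticRank_eq_one_of_prop121_supersingular_OPEN_of_thm101_OPEN_of_mordellWeilRank_eq_one
    (h121 : prop121_pConverse_of_signedCharIdealLe_supersingular_OPEN.{0})
    (h101 : thm101_signedMainStatement_semistable_OPEN)
    (h101t : thm101_twist_signedMainStatement_OPEN)
    (hpar : ∀ (W : WeierstrassCurve ℚ) [W.IsElliptic] (p : ℕ) [Fact p.Prime], p_parity W p)
    (hFH : friedbergHoffstein_exists_heegnerField_split_twist_ne_zero)
    (hKato : ∀ (W : WeierstrassCurve ℚ) [W.IsElliptic] (p : ℕ) [Fact p.Prime],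
      kato_finite_of_L_one_ne_zero W p)
    (hE : hasEntireLFunction_rat)
    (W : WeierstrassCurve ℚ) [W.IsElliptic] [W.IsGloballyMinimal] (p : ℕ) [Fact p.Prime]
    (hp2 : p ≠ 2) (hsst : Semistable W) (hgood : W.HasGoodReductionAtPrime p)
    (hap : W.frobeniusTrace p = 0) (hrank : W.mordellWeilRank = 1)
    (hsha : Finite (AddCommGroup.primaryComponent W.sha p)) : W.analyticRank = 1 := by
  haveI := hsha
  exact analyticRank_eq_one_of_prop121_supersingular_OPEN_of_thm101_OPEN_of_selmerCorank_eq_one h121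
    h101 h101t hpar hFH hKato hE W p hp2 hsst hgood hap
    (selmerCorank_eq_one_of_mordellWeilRank_eq_one_of_finite W p hrank hsha) hsha

/-! ### §4. Cor. 12.4 for an elliptic curve, BOTH cases `r ∈ {0, 1}`, modulo the ordinary
Prop. 12.1 binder + REFEREED print (appended, v2) -/

/-- **Burungale–Skinner–Tian–Wan Cor. 12.4 (label pcv-w, p. 96) for an elliptic curve, both cases
`r ∈ {0, 1}` — REPLAYED modulo the ordinary Prop. 12.1 OPEN binder and named REFEREED print.**
«For `r ∈ {0,1}`, `rank_ℤ A_g(ℚ) = r [F:ℚ]`, `#Ш(A_g) < ∞` ⟹ `ord_{s=1} L(s, A_g) = r [F:ℚ]`» for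
`A_g = E`: for EVERY elliptic curve `E/ℚ` (globally minimal model `W`),
`rank_ℤ E(ℚ) ≤ 1 ∧ #Ш(E/ℚ) < ∞ ⟹ ord_{s=1} L(E, s) = rank_ℤ E(ℚ)`. Proof as printed: «pick an
ordinary prime `p ∤ 2N` so that `ρ` satisfies (irr_ℚ)»
(`exists_gt_mem_goodOrdinaryPrimes_hasIrreducibleModPGaloisRep`, `p > 4`); «by the hypothesis,
`corank Sel_{λ^∞}(A_g) = r` and `Ш(A_g)[λ^∞]` is finite» (corank identity); «the `r = 1` case follows
from Theorem 12.3» (`analyticRank_eq_one_of_prop121_ordinary_OPEN_of_mordellWeilRank_eq_one_of_finite_sha`)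
«and the `r = 0` case from Theorem 9.21 (c)» — in the tree a THEOREM below modularity and the REFEREED
BCS25 1.1.2 (a) alone (`analyticRank_eq_zero_of_selmerCorank_eq_zero_of_mazurMainConjecture`, Greenberg
LNM 1716 Thm. 4.1). Modularity enters once, as `exists_isNewformOf` (`hmod`; the entire continuation
`hasEntireLFunction_rat` follows, `hasEntireLFunction_rat_of_exists_isNewformOf`). Trust base: ONE
preprint binder (used only when `r = 1`) + BCS25 1.1.2 (a), parity, Friedberg–Hoffstein, Kato 14.2,
modularity. [claim: BurungaleSkinnerTianWan2024, status: under-review]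
[cite: BurungaleSkinnerTianWan2024, Cor. 12.4 and its proof (p. 96; label pcv-w, tex l.8189–8206), Thm. 12.3 (p. 96), Prop. 12.1 (p. 95; OPEN binder)]
[cite: BurungaleCastellaSkinner2025, Thm. 1.1.2 (a) (p. 2 of arXiv:2405.00270v2)]
[cite: Greenberg1999LNM, Thm. 4.1 (p. 102) and §1 pp. 65–66] -/
theorem analyticRank_eq_mordellWeilRank_of_prop121_ordinary_OPEN_of_le_one
    (h121 : prop121_pConverse_of_charIdealLe_ordinary_OPEN.{0})
    (hBCS : burungale_castella_skinner_charIdeal_eq_padicLFunction)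
    (hmod : Literature.NumberTheory.EllipticCurves.ModularForms.exists_isNewformOf)
    (hpar : ∀ (W : WeierstrassCurve ℚ) [W.IsElliptic] (p : ℕ) [Fact p.Prime], p_parity W p)
    (hFH : friedbergHoffstein_exists_heegnerField_split_twist_ne_zero)
    (hKato : ∀ (W : WeierstrassCurve ℚ) [W.IsElliptic] (p : ℕ) [Fact p.Prime],
      kato_finite_of_L_one_ne_zero W p)
    (W : WeierstrassCurve ℚ) [W.IsElliptic] [W.IsGloballyMinimal] (hrank : W.mordellWeilRank ≤ 1)
    [Finite W.sha] : W.analyticRank = W.mordellWeilRank := by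
  rcases Nat.le_one_iff_eq_zero_or_eq_one.mp hrank with h0 | h1
  · -- `r = 0`: «from Theorem 9.21 (c)» — below modularity + BCS25 1.1.2 (a)
    obtain ⟨p, h4p, ⟨hpF, hgood, hord⟩, hirr⟩ :=
      exists_gt_mem_goodOrdinaryPrimes_hasIrreducibleModPGaloisRep W 4
    haveI := hpF
    have hc0 : W.selmerCorank p = 0 := by
      have hs : W.shaCorank p = 0 := zpCorank_eq_zero_of_finite _ p
      have h := W.selmerCorank_eq_mordellWeilRank_add_holds p
      omega
    rw [h0]
    exact analyticRank_eq_zero_of_selmerCorank_eq_zero_of_mazurMainConjecture hmod hBCS W p (by omega)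
      hgood hord hirr hc0
  · -- `r = 1`: Theorem 12.3
    rw [h1]
    exact analyticRank_eq_one_of_prop121_ordinary_OPEN_of_mordellWeilRank_eq_one_of_finite_sha h121
      hBCS hpar hFH hKato (hasEntireLFunction_rat_of_exists_isNewformOf hmod) W h1

/-! ### §5. The REFEREED interim statement bsd.S25 (Kim 2022, Cor. 1.4) reached from the ordinary
Prop. 12.1 binder (appended, v3) -/

/-- **bsd.S25 = Kim 2022 Cor. 1.4 (`kim_analyticRank_eq_one_of_mordellWeilRank_eq_one`) REACHED A
SECOND WAY: from Burungale–Skinner–Tian–Wan's ordinary Prop. 12.1 (OPEN binder, PREPRINT) + the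
REFEREED BCS25 Thm. 1.1.2 (a) + the `p`-parity theorem + Friedberg–Hoffstein + Gross–Zagier–Kolyvagin
(bsd.S17 `rank_eq_analyticRank_of_analyticRank_le_one`, which also yields Kato's finiteness input,
`kato_finite_of_L_one_ne_zero_of_rank_eq_analyticRank`, and the printed "in particular `#Ш < ∞`")
+ modularity.** The non-CM hypothesis of the target is NOT used; `3 < p` prime gives `5 ≤ p`. This is
BSTW Thm. 12.3 (`analyticRank_eq_one_of_prop121_ordinary_OPEN_of_mordellWeilRank_eq_one`) in the shape
of the tree's refereed twin (same hypothesis list: Kim's Cor. 1.4 and BSTW's Thm. 12.3 at `p ≥ 5` are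
the same statement for non-CM `E`; BSTW Remark after Cor. 12.4: "the above result is also independently
obtained by Kim [Ki1]"). Between a binder and a named fact; discharges nothing.
[claim: BurungaleSkinnerTianWan2024, status: under-review]
[cite: BurungaleSkinnerTianWan2024, Thm. 12.3 (p. 96) and the Remark after Cor. 12.4 (p. 96), Prop. 12.1 (p. 95; OPEN binder)]
[cite: Kim2022, Cor. 1.4] [cite: BurungaleCastellaSkinner2025, Thm. 1.1.2 (a) (p. 2 of arXiv:2405.00270v2)] -/
theorem kim_analyticRank_eq_one_of_mordellWeilRank_eq_one_of_prop121_ordinary_OPEN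
    (h121 : prop121_pConverse_of_charIdealLe_ordinary_OPEN.{0})
    (hBCS : burungale_castella_skinner_charIdeal_eq_padicLFunction)
    (hpar : ∀ (W : WeierstrassCurve ℚ) [W.IsElliptic] (p : ℕ) [Fact p.Prime], p_parity W p)
    (hFH : friedbergHoffstein_exists_heegnerField_split_twist_ne_zero)
    (hGZK : rank_eq_analyticRank_of_analyticRank_le_one) (hE : hasEntireLFunction_rat) :
    kim_analyticRank_eq_one_of_mordellWeilRank_eq_one := by
  intro W _ _ _hcm p _ hp hgood hord hirr hrank hsha
  have hp4 : p ≠ 4 := by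
    rintro rfl
    exact absurd (Fact.out : Nat.Prime 4) (by decide)
  have h1 : W.analyticRank = 1 :=
    analyticRank_eq_one_of_prop121_ordinary_OPEN_of_mordellWeilRank_eq_one h121 hBCS hpar hFH
      (fun W _ p _ ↦ kato_finite_of_L_one_ne_zero_of_rank_eq_analyticRank W p hGZK) hE W p (by omega)
      hgood hord hirr hrank hsha
  exact ⟨h1, (hGZK W h1.le).2⟩

/-! ### §6. Model-free forms of Cor. 12.4 (any Weierstrass model of `E/ℚ`) and the equivalence with
Gross–Zagier–Kolyvagin (appended, v4) -/

/-- **Cor. 12.4 (`r ∈ {0,1}`) for ANY model of `E/ℚ`** (not necessarily globally minimal), modulo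
the ordinary Prop. 12.1 binder + REFEREED print: pass to a global minimal model `C • W`
(`hasGlobalMinimalModel_rat_holds`, Silverman VIII.8.3); `rank`, `#Ш < ∞` and `ord_{s=1} L(E,s)` are
isomorphism invariants (`mordellWeilRank_variableChange_holds`, `shaEquiv`, `analyticRank_smul`).
[claim: BurungaleSkinnerTianWan2024, status: under-review]
[cite: BurungaleSkinnerTianWan2024, Cor. 12.4 and its proof (p. 96; label pcv-w, tex l.8189–8206), Prop. 12.1 (p. 95; OPEN binder)]
[cite: SilvermanAEC2009, VIII.8 Cor. 8.3 and App. C §16] -/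
theorem analyticRank_eq_mordellWeilRank_of_prop121_ordinary_OPEN_of_le_one'
    (h121 : prop121_pConverse_of_charIdealLe_ordinary_OPEN.{0})
    (hBCS : burungale_castella_skinner_charIdeal_eq_padicLFunction)
    (hmod : Literature.NumberTheory.EllipticCurves.ModularForms.exists_isNewformOf)
    (hpar : ∀ (W : WeierstrassCurve ℚ) [W.IsElliptic] (p : ℕ) [Fact p.Prime], p_parity W p)
    (hFH : friedbergHoffstein_exists_heegnerField_split_twist_ne_zero)
    (hKato : ∀ (W : WeierstrassCurve ℚ) [W.IsElliptic] (p : ℕ) [Fact p.Prime],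
      kato_finite_of_L_one_ne_zero W p)
    (W : WeierstrassCurve ℚ) [W.IsElliptic] (hrank : W.mordellWeilRank ≤ 1) (hsha : Finite W.sha) :
    W.analyticRank = W.mordellWeilRank := by
  obtain ⟨C, hC⟩ := hasGlobalMinimalModel_rat_holds W
  have hrk : (C • W).mordellWeilRank = W.mordellWeilRank := mordellWeilRank_variableChange_holds W C
  haveI : Finite (C • W).sha := (Equiv.finite_iff (shaEquiv W C)).mp hsha
  have h := analyticRank_eq_mordellWeilRank_of_prop121_ordinary_OPEN_of_le_one h121 hBCS hmod hpar hFH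
    hKato (C • W) (by rw [hrk]; exact hrank)
  rwa [analyticRank_smul, hrk] at h

/-- **The converse to Gross–Zagier–Kolyvagin in rank one for EVERY elliptic curve over `ℚ`, any model:
`rank_ℤ E(ℚ) = 1 ∧ #Ш(E/ℚ) < ∞ ⟹ ord_{s=1} L(E, s) = 1`**, modulo the ordinary Prop. 12.1 binder +
REFEREED print (the tree's `analyticRank_eq_one_of_mordellWeilRank_eq_one_of_finite_sha`, Kim 2022
diagram (1.1) via Kim Cor. 1.4 + Burungale–Tian, reached without the CM split).
[claim: BurungaleSkinnerTianWan2024, status: under-review]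
[cite: BurungaleSkinnerTianWan2024, Cor. 12.4 (p. 96; label pcv-w), Prop. 12.1 (p. 95; OPEN binder)]
[cite: Kim2022, §1, diagram (1.1)] -/
theorem analyticRank_eq_one_of_prop121_ordinary_OPEN_of_mordellWeilRank_eq_one_of_finite_sha'
    (h121 : prop121_pConverse_of_charIdealLe_ordinary_OPEN.{0})
    (hBCS : burungale_castella_skinner_charIdeal_eq_padicLFunction)
    (hmod : Literature.NumberTheory.EllipticCurves.ModularForms.exists_isNewformOf)
    (hpar : ∀ (W : WeierstrassCurve ℚ) [W.IsElliptic] (p : ℕ) [Fact p.Prime], p_parity W p)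
    (hFH : friedbergHoffstein_exists_heegnerField_split_twist_ne_zero)
    (hKato : ∀ (W : WeierstrassCurve ℚ) [W.IsElliptic] (p : ℕ) [Fact p.Prime],
      kato_finite_of_L_one_ne_zero W p)
    (W : WeierstrassCurve ℚ) [W.IsElliptic] (hrank : W.mordellWeilRank = 1) (hsha : Finite W.sha) :
    W.analyticRank = 1 := by
  rw [analyticRank_eq_mordellWeilRank_of_prop121_ordinary_OPEN_of_le_one' h121 hBCS hmod hpar hFH hKato
    W hrank.le hsha, hrank]

/-- **`rank_ℤ E(ℚ) = 1 ∧ #Ш(E/ℚ) < ∞ ⟺ ord_{s=1} L(E, s) = 1` for EVERY elliptic curve over `ℚ`**,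
modulo the ordinary Prop. 12.1 binder + REFEREED print, the backward direction (and Kato's finiteness
input of the forward one) being Gross–Zagier–Kolyvagin (bsd.S17, `hGZK`,
`kato_finite_of_L_one_ne_zero_of_rank_eq_analyticRank`). The tree's
`mordellWeilRank_eq_one_and_finite_sha_iff_analyticRank_eq_one` (Kim Cor. 1.4 + Burungale–Tian + GZK)
from a different base. [claim: BurungaleSkinnerTianWan2024, status: under-review]
[cite: BurungaleSkinnerTianWan2024, Cor. 12.4 (p. 96; label pcv-w), Prop. 12.1 (p. 95; OPEN binder)]
[cite: Darmon2004, Thm. 3.22] -/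
theorem mordellWeilRank_eq_one_and_finite_sha_iff_analyticRank_eq_one_of_prop121_ordinary_OPEN
    (h121 : prop121_pConverse_of_charIdealLe_ordinary_OPEN.{0})
    (hBCS : burungale_castella_skinner_charIdeal_eq_padicLFunction)
    (hmod : Literature.NumberTheory.EllipticCurves.ModularForms.exists_isNewformOf)
    (hpar : ∀ (W : WeierstrassCurve ℚ) [W.IsElliptic] (p : ℕ) [Fact p.Prime], p_parity W p)
    (hFH : friedbergHoffstein_exists_heegnerField_split_twist_ne_zero)
    (hGZK : rank_eq_analyticRank_of_analyticRank_le_one) (W : WeierstrassCurve ℚ) [W.IsElliptic] :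
    (W.mordellWeilRank = 1 ∧ Finite W.sha) ↔ W.analyticRank = 1 := by
  refine ⟨fun h ↦ analyticRank_eq_one_of_prop121_ordinary_OPEN_of_mordellWeilRank_eq_one_of_finite_sha'
    h121 hBCS hmod hpar hFH (fun W _ p _ ↦ kato_finite_of_L_one_ne_zero_of_rank_eq_analyticRank W p hGZK)
    W h.1 h.2, fun h ↦ ?_⟩
  obtain ⟨hrank, hsha⟩ := hGZK W h.le
  exact ⟨by rw [hrank, h], hsha⟩

end Literature.NumberTheory.EllipticCurves.BurungaleSkinnerTianWan2024

end
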